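import Summits.ResolutionOfSingularities.ResolutionOfSingularities.Theorems.FrobeniusLadderFRationalResolutionBlowupFlatCriteria
import Literature.AlgebraicGeometry.Resolution.MarkedIdealsLemmas
import Literature.AlgebraicGeometry.Resolution.BlowupsFlatBaseChange
import HarnessLib

/-!
# Crux `FrobeniusLadder.FRationalResolution` (stmt-ResolutionOfSingularities-15317), line `redirect`,
# stub `stub_diagonalizableQuotientResolution` — INTRINSIC SECOND CENTRES: vanishing ideals of automorphism-stable closed sets
# (discharging the hypothesis `h𝒦` of `…CharacteristicTower.exists_characteristic_ideal_of_tower` for the conifold step)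

`…CharacteristicTower` (this generation) packages a two-step tower `Bl_𝒦(Bl_{J₁}(Spec R)) → Spec R` into the blowing up of ONE
characteristic ideal, provided the second centre `𝒦` satisfies `Θ⁻¹𝒦 ⊆ 𝒦` for the automorphisms `Θ` of `X₁ = Bl_{J₁}(Spec R)`
(covering automorphisms of `Spec R`). Here that hypothesis is discharged for the centres the intrinsic recipe actually uses
(MEMO-15317-leafhand2-g16 §2(c): the reduced ideal of the finitely many conifold points of `X₁`, i.e. of its singular locus):

* `comap_hom_eq_map_inv` — for an isomorphism `Θ`, pull-back along `Θ` is push-forward along `Θ⁻¹` (Mathlib's Galois connection);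
* `comap_vanishingIdeal_le_of_image_subset` — **`Θ⁻¹ 𝓘_Z ⊆ 𝓘_Z` for every closed `Z` with `Θ(Z) ⊆ Z`** (`𝓘_Z` = Mathlib's
  `Scheme.IdealSheafData.vanishingIdeal Z`, the radical ideal sheaf of `Z`); powers `comap_vanishingIdeal_pow_le_of_image_subset`;
* `image_compl_regularLocus_subset` — an automorphism maps the singular locus into itself (stalks are isomorphic), so
  `comap_vanishingIdeal_singularLocus_le`: **the reduced ideal of the (closed) singular locus is stable under EVERY automorphism**;
* `idealSheaf_comap_le_vanishingIdeal_of_subset` — primary-ness bookkeeping `p⁻¹(𝔪~) ⊆ 𝓘_Z` whenever `p(Z) ⊆ V(𝔪)` (the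
  hypothesis `hb` of `…CharacteristicTower.exists_characteristic_ideal_isRegular_of_tower` with `b = 1`).

Honest label: plumbing toward ONE leaf stub (no stub, crux or summit closed). No definitions, no named facts, no sorry.
[cite: GortzWedhorn2020, Prop. 13.91] [cite: StacksProject, Tag 01J3; Tag 080B] [folklore]
-/

noncomputable section

-- single-problem summit: the doubled namespace component is forced
set_option linter.dupNamespace false

open CategoryTheory CategoryTheory.Limits AlgebraicGeometry TopologicalSpace
open Literature.AlgebraicGeometry.Resolution
open Summit.ResolutionOfSingularities.ResolutionOfSingularities.Theorems.FRationalResolution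

namespace Summit.ResolutionOfSingularities.ResolutionOfSingularities.Theorems.FRationalResolution.CharacteristicTowerCentre

/-! ## §1 Pull-back along an isomorphism -/

/-- For an isomorphism `Θ`, `Θ⁻¹𝒦·𝒪 = (Θ⁻¹)_* 𝒦`: pull-back along `Θ` equals push-forward along `Θ⁻¹`. [folklore] -/
theorem comap_hom_eq_map_inv {X Y : Scheme.{0}} (Θ : X ≅ Y) (𝒦 : Y.IdealSheafData) :
    𝒦.comap Θ.hom = 𝒦.map Θ.inv := by
  refine le_antisymm ?_ ?_
  · rw [Scheme.IdealSheafData.le_map_iff_comap_le, ← Scheme.IdealSheafData.comap_comp, Θ.inv_hom_id,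
      Scheme.IdealSheafData.comap_id]
  · have h : ((𝒦.map Θ.inv).comap Θ.inv).comap Θ.hom ≤ 𝒦.comap Θ.hom :=
      Scheme.IdealSheafData.comap_mono Θ.hom (Scheme.IdealSheafData.comap_map_le _ _)
    rwa [← Scheme.IdealSheafData.comap_comp, Θ.hom_inv_id, Scheme.IdealSheafData.comap_id] at h

/-! ## §2 Vanishing ideals of stable closed sets -/

/-- **`Θ⁻¹ 𝓘_Z ⊆ 𝓘_Z` for a closed set `Z` with `Θ(Z) ⊆ Z`** (`Θ` an automorphism): `Θ⁻¹𝓘_Z = (Θ⁻¹)_*𝓘_Z = 𝓘_{cl Θ⁻¹(Z)}`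
(Mathlib `map_vanishingIdeal`) and `Z ⊆ Θ⁻¹(Z)` because `Θ(Z) ⊆ Z`. [folklore] -/
theorem comap_vanishingIdeal_le_of_image_subset {X : Scheme.{0}} (Θ : X ≅ X) (Z : Closeds X)
    (hZ : Θ.hom '' (Z : Set X) ⊆ Z) :
    (Scheme.IdealSheafData.vanishingIdeal Z).comap Θ.hom ≤ Scheme.IdealSheafData.vanishingIdeal Z := by
  rw [comap_hom_eq_map_inv, Scheme.IdealSheafData.map_vanishingIdeal]
  refine Scheme.IdealSheafData.vanishingIdeal_antimono ?_
  intro z hz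
  refine subset_closure ⟨Θ.hom z, hZ ⟨z, hz, rfl⟩, ?_⟩
  change (Θ.hom ≫ Θ.inv) z = z
  rw [Θ.hom_inv_id]
  rfl

/-- Powers: `Θ⁻¹ 𝓘_Zᵐ ⊆ 𝓘_Zᵐ` under the same hypothesis. [folklore] -/
theorem comap_vanishingIdeal_pow_le_of_image_subset {X : Scheme.{0}} (Θ : X ≅ X) (Z : Closeds X)
    (hZ : Θ.hom '' (Z : Set X) ⊆ Z) (m : ℕ) :
    (Scheme.IdealSheafData.vanishingIdeal Z ^ m).comap Θ.hom ≤ Scheme.IdealSheafData.vanishingIdeal Z ^ m := by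
  rw [comap_pow]
  exact pow_le_pow_left₀ bot_le (comap_vanishingIdeal_le_of_image_subset Θ Z hZ) m

/-! ## §3 The singular locus is stable under automorphisms -/

/-- An automorphism maps singular points to singular points (the local rings are isomorphic). [folklore] -/
theorem image_compl_regularLocus_subset {X : Scheme.{0}} (Θ : X ≅ X) :
    Θ.hom '' (Scheme.regularLocus X)ᶜ ⊆ (Scheme.regularLocus X)ᶜ := by
  rintro _ ⟨x, hx, rfl⟩ h
  exact hx ((mem_regularLocus_iff_of_flat_of_isPreimmersion Θ.hom x).mpr h)

/-- **The reduced ideal of the singular locus is stable under every automorphism** (when the singular locus is closed, e.g. finite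
and consisting of closed points, or `X` quasi-excellent): `Θ⁻¹ 𝓘_{Sing X}ᵐ ⊆ 𝓘_{Sing X}ᵐ`. [folklore] -/
theorem comap_vanishingIdeal_singularLocus_pow_le {X : Scheme.{0}} (hcl : IsClosed (Scheme.regularLocus X)ᶜ) (Θ : X ≅ X)
    (m : ℕ) :
    (Scheme.IdealSheafData.vanishingIdeal ⟨(Scheme.regularLocus X)ᶜ, hcl⟩ ^ m).comap Θ.hom ≤
      Scheme.IdealSheafData.vanishingIdeal ⟨(Scheme.regularLocus X)ᶜ, hcl⟩ ^ m :=
  comap_vanishingIdeal_pow_le_of_image_subset Θ _ (image_compl_regularLocus_subset Θ) m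

/-- The hypothesis `h𝒦` of `…CharacteristicTower.exists_characteristic_ideal_of_tower` for `𝒦 = 𝓘_{Sing X₁}ᵐ` on
`X₁ = Bl_{J₁}(Spec R)` (closed singular locus): it holds for EVERY automorphism of `X₁`, covering or not. [folklore] -/
theorem h𝒦_singularLocus_pow {R : Type} [CommRing R] (J₁ : Ideal R)
    (hcl : IsClosed (Scheme.regularLocus (affineBlowup J₁))ᶜ) (m : ℕ) :
    ∀ Θ : affineBlowup J₁ ≅ affineBlowup J₁,
      (∃ σ : Spec (.of R) ⟶ Spec (.of R), Θ.hom ≫ affineBlowup.π J₁ = affineBlowup.π J₁ ≫ σ) →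
      (Scheme.IdealSheafData.vanishingIdeal ⟨(Scheme.regularLocus (affineBlowup J₁))ᶜ, hcl⟩ ^ m).comap Θ.hom ≤
        Scheme.IdealSheafData.vanishingIdeal ⟨(Scheme.regularLocus (affineBlowup J₁))ᶜ, hcl⟩ ^ m :=
  fun Θ _ => comap_vanishingIdeal_singularLocus_pow_le hcl Θ m

/-! ## §4 Primary-ness bookkeeping for vanishing ideals -/

/-- **`p⁻¹(𝔪~) ⊆ 𝓘_Z` whenever `p(Z) ⊆ V(𝔪)`**: for `p : X₁ → Spec R`, an ideal `𝔪 ⊆ R` and a closed `Z ⊆ X₁` all of whose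
points map into `V(𝔪)`, the pulled-back ideal sheaf `p⁻¹(𝔪~)·𝒪_{X₁}` lies in the vanishing ideal of `Z` (Mathlib's Galois
connection `support ⊣ vanishingIdeal`; the support of `p⁻¹(𝔪~)` is `p⁻¹(V(𝔪))`). [folklore] -/
theorem idealSheaf_comap_le_vanishingIdeal_of_subset {R : Type} [CommRing R] {X₁ : Scheme.{0}} (p : X₁ ⟶ Spec (.of R))
    (𝔪 : Ideal R) (Z : Closeds X₁) (hZ : ∀ z ∈ (Z : Set X₁), 𝔪 ≤ (p z).asIdeal) :
    (affineBlowup.idealSheaf 𝔪).comap p ≤ Scheme.IdealSheafData.vanishingIdeal Z := by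
  rw [← Scheme.IdealSheafData.le_support_iff_le_vanishingIdeal]
  intro z hz
  rw [Scheme.IdealSheafData.support_comap]
  change p z ∈ ((affineBlowup.idealSheaf 𝔪).support : Set (Spec (.of R)))
  rw [affineBlowup.support_idealSheaf]
  exact hZ z hz

/-- Powers: `p⁻¹(𝔪~) ⊆ 𝓘_Zᵐ` fails in general, but `p⁻¹((𝔪ᵐ)~) ⊆ 𝓘_Zᵐ`. [folklore] -/
theorem idealSheaf_pow_comap_le_vanishingIdeal_pow_of_subset {R : Type} [CommRing R] {X₁ : Scheme.{0}}
    (p : X₁ ⟶ Spec (.of R)) (𝔪 : Ideal R) (Z : Closeds X₁) (hZ : ∀ z ∈ (Z : Set X₁), 𝔪 ≤ (p z).asIdeal) (m : ℕ) :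
    (affineBlowup.idealSheaf (𝔪 ^ m)).comap p ≤ Scheme.IdealSheafData.vanishingIdeal Z ^ m := by
  have h : affineBlowup.idealSheaf (𝔪 ^ m) = affineBlowup.idealSheaf 𝔪 ^ m := by
    simp only [affineBlowup.idealSheaf, Ideal.map_pow, ← Scheme.IdealSheafData.equivOfIsAffine_symm_apply, map_pow]
  rw [h, comap_pow]
  exact pow_le_pow_left₀ bot_le (idealSheaf_comap_le_vanishingIdeal_of_subset p 𝔪 Z hZ) m

end Summit.ResolutionOfSingularities.ResolutionOfSingularities.Theorems.FRationalResolution.CharacteristicTowerCentre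

end
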